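import Literature.AlgebraicGeometry.ComplexMultiplication.RosatiPolarizationCM
import Literature.NumberTheory.Automorphic.Liu2021.Prop46NonemptyOfCasselman
import HarnessLib

/-!
# [Liu 2021] Definition 4.5 (2), third bullet — the polarisation `λ_μ` with `λ ∘ i_μ(x) = i_μ(x̄)^∨ ∘ λ` — REAL, and supplied

Y. Liu, *Fourier–Jacobi cycles and arithmetic relative trace formula*, Camb. J. Math. **9** (2021) = arXiv:2102.11518
[Liu2021]; TeX source `FJcycle.tex`, §4.1, Definition 4.5 (2) (ll. 1944–1958) and the proof of Prop. 4.6 (1)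
(ll. 1975–1984).  Sub-row (CP-S4c-P) of the pub-hodgecm2 team table `HOME/pinning/HCMISOG-TABLE.md` = red-team
WATCH W1 (hodge-director/TGTBT.md D18.3 item 1, D19–D21): «either `P A i` carries the printed predicate (λ-compatibility
at least; λ_μ exists by [Shi71, Thm 5], print l. 1982) or `hLiu` is re-classed».

AS PRINTED (l. 1955), VERBATIM: «• `λ_μ : A_μ → A_μ^∨` is a polarization satisfying `λ ∘ i_μ(x) = i_μ(x̄)^∨ ∘ λ` for
every `x ∈ M_μ`,»; proof of Prop. 4.6 (1), l. 1982–1984: «… Then `A_μ` is an element in `𝒜(μ)` (with the obvious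
choices of `λ_μ` and `r_μ`).»

## What this file does

In `Def45AsPrinted` (item6-p1) the pair `(λ_μ, r_μ)` of bullets 3–4 is a ⟨CARRIER⟩ `Carriers.PolDR : ∀ A i, Type`; every END
display keeps a free token `P : ∀ A : AbelianVariety F, (M_μ →+* End⁰ A) → Type` with `Car := Carriers.ofPolDR μ P` (b25's
`nonempty_cmDatum_of_casselman (h21) (hu) (hπ) (P) (hP : ∀ A i, Nonempty (P A i))`).  With `P` free the object type may exceed `𝒜(μ)`.

* §1 `Def45.IsPolarisationClass τ₀ A i θ₂` — the THIRD BULLET typed REAL in the tree's cohomological currency (the tree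
  has no dual abelian variety / polarisation `A → A^∨` over a number field; it has polarisation CLASSES): for
  `A` over `k ⊆ ℂ`, `i : K →+* End⁰(A)` and `θ₂ ∈ H²(A_ℂ(ℂ); ℚ)`: `θ₂` is a rational ALGEBRAIC class
  (`PicardCM.ratAlgebraicClasses _ 1`, the class of a divisor), a non-zero real multiple of `θ₂ ⊗ 1` is a KÄHLER class
  (`HodgeTheory.IsKaehlerClass` — ampleness of the divisor class up to sign, Kodaira), and the
  ROSATI RELATION of l. 1955 read on `H¹(A_ℂ(ℂ); ℂ)` through the polarization pairing
  `Q_{θ₂}(x, y) = θ₂^{dim A - 1} ⌣ x ⌣ y` (`Motives.polarizationPairingOne`, [LangeBirkenhake1992] Lemma 1.1.17 / §5.1: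
  the Rosati involution `f ↦ λ⁻¹ f^∨ λ` is the adjunction for the Riemann form): for all `x ∈ K` and `x̄` its complex
  conjugate (`τ₀ x̄ = conj (τ₀ x)` along the given embedding `τ₀ : K → ℂ`; for Liu `K = M_μ ⊆ ℂ`, `τ₀` the inclusion),
  `Q_{θ₂}(i(x)^* u, v) = Q_{θ₂}(u, i(x̄)^* v)`, where `i(x)^*` is the complexified rational action
  `ComplexMultiplication.complexAction (i ⊗ ℂ) x` on `H¹` ([Shimura1998] §5.2).  READING P-R1: «`λ ∘ i_μ(x) = i_μ(x̄)^∨ ∘ λ`»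
  ⟺ the Rosati involution of `λ` induces complex conjugation on `i_μ(M_μ)` ⟺ (on `H¹`, where `End⁰(A)` acts faithfully)
  `E_λ(i(x) u, v) = E_λ(u, i(x̄) v)` for the Riemann form — [MilneCM2006] §3 p. 31, [Shimura1998] §6.2 Thm. 4 (3).
* §1 `Def45.PolDR σ hμ R : ∀ A i, Type := {θ₂ // IsPolarisationClass (M_μ ⊆ ℂ) A i θ₂} × R A i` — the carrier with bullet 3
  REAL; the FOURTH BULLET `r_μ : M_μ ⊗_ℚ E → H_1^{dR}(A_μ/E)` (l. 1957) STAYS the token `R` (no algebraic de Rham homology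
  over a number field in the tree) — declared, not hidden.
* §2 `Def45.pairing_complexAction_eq_of_integer` — from the INTEGRAL Rosati relation of the tree theorem
  `IsCMTypeRealisation.exists_rosati_ratClass` (`Q(ι(a)^*x, y) = Q(x, ι(ā)^*y)` for `a ∈ 𝓞_K`) to the RATIONAL one for all
  `x ∈ K` (clearing denominators in `K = Frac 𝓞_K`; `complexAction` is a ring homomorphism);
  `Def45.exists_isPolarisationClass_of_isCMTypeRealisationOver` — **every structure `(A₀, ι₀)` of CM type `(K, Φ)` over
  `k ⊆ ℂ`, with rational extension `i`, carries a polarisation class satisfying bullet 3** ([Shimura1998] §6.2 Thm. 4 (3),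
  the tree's `RosatiPolarizationCM`; this is the «λ_μ obvious» of l. 1984 / [Shi71] Thm. 5).
* §3 `Def45.nonempty_cmDatum_of_casselman_of_supply` — b25's `nonempty_cmDatum_of_casselman` (p314768) with the supply
  hypothesis `hP` WEAKENED from «every `(A, i)`» to «every INTEGRAL structure of CM type `Ψ̃_μ` over `F` with its rational
  extension» (b25's public steps re-run verbatim — credit b25); `Def45.nonempty_cmDatum_polarised_of_casselman (h21) (hu)
  (hπ) (R) (hR)` — Prop. 4.6 (1) over `Carriers.ofPolDR μ (PolDR σ hμ R)` with BULLET 3 PROVED, modulo the cite `h21`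
  ([Shimura1998] Thm. 21.4), b25's displayed `μ`-hypotheses `hu`/`hπ` (discharged in his sequels) and the de Rham token `hR`.

EFFECT for the END displays (pin-3's `…RestOne` re-cuts): the free token `P F ι₁ V Φ` can be SPECIALISED to the defined
carrier `Def45.PolDR ι₁ (isConjugateSymplectic_muOfInvType ι₁ Φ) (R F ι₁ V Φ)`; W1 shrinks from `(λ_μ, r_μ)` to `r_μ`.
HONEST SCOPE.  Nothing here constructs Liu's `X_K`, `A_K`, `Ω(μ)` or touches `hM`; HC_CM is NOT proved.  A datum over
`PolDR` satisfies bullets 1–3 AS TYPED and posits bullet 4.  No new named fact (D-0026 debt 0): §2 rests on tree THEOREMS.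

## References
* [Liu2021] Y. Liu, Camb. J. Math. 9 (2021) = arXiv:2102.11518 — Def. 4.5 (2) (TeX ll. 1944–1958, bullet 3 = l. 1955),
  Prop. 4.6 (1) (l. 1969) and its proof (ll. 1975–1984).
* [Shimura1998] G. Shimura, *Abelian Varieties with Complex Multiplication and Modular Functions* (1998), §5.1–§5.2,
  §6.2 Thm. 4 (3), §21.4 Thm. 21.4.
* [Shimura1971ZetaCM] G. Shimura, Ann. of Math. 94 (1971), Thm. 5 and Thm. 6 (as cited by [Liu2021] l. 1977–1982).
* [MilneCM2006] J. S. Milne, *Complex Multiplication* (2020), Ex. 2.9, §3, Prop. 3.17; [LangeBirkenhake1992] Lemma 1.1.17, §5.1.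
-/

set_option autoImplicit false

noncomputable section

open scoped TensorProduct NumberField ComplexConjugate
open CategoryTheory IsDedekindDomain NumberField
open Literature.AlgebraicGeometry.Motives Literature.AlgebraicGeometry.HodgeTheory
open Literature.AlgebraicGeometry.ComplexMultiplication
open Literature.NumberTheory.ComplexMultiplication
open Literature.NumberTheory.GaloisRepresentations
open Literature.AlgebraicTopology.SingularHomology
open Literature.Geometry.Kaehler
open Literature.NumberTheory.Automorphic (PicardCM.ratAlgebraicClasses PicardCM.mem_ratAlgebraicClasses_iff)

namespace Literature.NumberTheory.Automorphic.Liu2021.Def45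

/-! ## §1 The third bullet of Def. 4.5 (2), typed REAL; the carrier `PolDR` -/

section Predicate

variable {k : Type} [Field k] [Algebra k ℂ] {K : Type} [Field K] [NumberField K]

/-- **[Liu2021, Def. 4.5 (2)] THIRD BULLET (l. 1955) «`λ_μ : A_μ → A_μ^∨` is a polarization satisfying
`λ ∘ i_μ(x) = i_μ(x̄)^∨ ∘ λ` for every `x ∈ M_μ`», typed REAL** as a predicate on a class `θ₂ ∈ H²(A_ℂ(ℂ); ℚ)` of the base
change `A_ℂ = A ⊗_{k} ℂ` (along `algebraMap k ℂ`) of an abelian variety `A/k` with a rational action `i : K → End⁰(A)` of a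
number field `K` embedded in `ℂ` by `τ₀` (READING P-R1 of the module docstring):
(a) `θ₂` is a rational ALGEBRAIC class (`θ₂ ⊗ 1 ∈ N¹H²`, the class of a divisor);
(b) «polarization»: some non-zero real multiple of `θ₂ ⊗ 1` is a KÄHLER class of `A_ℂ(ℂ)` (an ample class up to sign);
(c) «`λ ∘ i_μ(x) = i_μ(x̄)^∨ ∘ λ`»: for every `x ∈ K` and `x̄ ∈ K` with `τ₀ x̄ = conj (τ₀ x)`, and all `u, v ∈ H¹(A_ℂ(ℂ); ℂ)`,
`Q_{θ₂}(i(x)^* u, v) = Q_{θ₂}(u, i(x̄)^* v)` for the polarization pairing `Q_{θ₂} = (θ₂ ⊗ 1)^{dim A - 1} ⌣ (· ⌣ ·)`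
(`Motives.polarizationPairingOne`) and the complexified rational action `i(x)^* = complexAction (i ⊗ ℂ) x`
([Shimura1998] §5.2).  DEFINED; inhabited for every structure of CM type (§2).
[cite: Liu2021, Def. 4.5 (2) (TeX l. 1955)] [cite: Shimura1998, §6.2 Theorem 4 (3) and §5.2]
[cite: MilneCM2006, §3 p. 31 and Prop. 3.17] [cite: LangeBirkenhake1992, Lemma 1.1.17 and §5.1] -/
def IsPolarisationClass (τ₀ : K →+* ℂ) (A : AbelianVariety k) (i : K →+* A.endAlgebra)
    (θ₂ : bettiCohomology (A.baseChange ℂ).X 2) : Prop :=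
  θ₂ ∈ PicardCM.ratAlgebraicClasses (A.baseChange ℂ).X 1 ∧
  (∃ s : ℝ, s ≠ 0 ∧
    IsKaehlerClass (A.baseChange ℂ).dim (A.baseChange ℂ).X
      ((s : ℂ) • ofRatClass (ComplexPoints (A.baseChange ℂ).X) 2 θ₂)) ∧
  ∀ x xc : K, τ₀ xc = conj (τ₀ x) → ∀ u v : complexBetti (A.baseChange ℂ).X 1,
    polarizationPairingOne (A.baseChange ℂ).X (ofRatClass (ComplexPoints (A.baseChange ℂ).X) 2 θ₂)
        ((A.baseChange ℂ).dim - 1)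
        (complexAction ((AbelianVariety.endAlgebraBaseChange ℂ A).toRingHom.comp i) x u) v =
      polarizationPairingOne (A.baseChange ℂ).X (ofRatClass (ComplexPoints (A.baseChange ℂ).X) 2 θ₂)
        ((A.baseChange ℂ).dim - 1) u
        (complexAction ((AbelianVariety.endAlgebraBaseChange ℂ A).toRingHom.comp i) xc v)

/-- Unfolding of `IsPolarisationClass` into its three clauses (a) algebraic, (b) polarisation (Kähler up to a non-zero
real scalar), (c) the Rosati relation of l. 1955 on `H¹`. [cite: Liu2021, Def. 4.5 (2) (TeX l. 1955)] -/
theorem isPolarisationClass_iff (τ₀ : K →+* ℂ) (A : AbelianVariety k) (i : K →+* A.endAlgebra)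
    (θ₂ : bettiCohomology (A.baseChange ℂ).X 2) :
    IsPolarisationClass τ₀ A i θ₂ ↔
      θ₂ ∈ PicardCM.ratAlgebraicClasses (A.baseChange ℂ).X 1 ∧
      (∃ s : ℝ, s ≠ 0 ∧
        IsKaehlerClass (A.baseChange ℂ).dim (A.baseChange ℂ).X
          ((s : ℂ) • ofRatClass (ComplexPoints (A.baseChange ℂ).X) 2 θ₂)) ∧
      ∀ x xc : K, τ₀ xc = conj (τ₀ x) → ∀ u v : complexBetti (A.baseChange ℂ).X 1,
        polarizationPairingOne (A.baseChange ℂ).X (ofRatClass (ComplexPoints (A.baseChange ℂ).X) 2 θ₂)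
            ((A.baseChange ℂ).dim - 1)
            (complexAction ((AbelianVariety.endAlgebraBaseChange ℂ A).toRingHom.comp i) x u) v =
          polarizationPairingOne (A.baseChange ℂ).X (ofRatClass (ComplexPoints (A.baseChange ℂ).X) 2 θ₂)
            ((A.baseChange ℂ).dim - 1) u
            (complexAction ((AbelianVariety.endAlgebraBaseChange ℂ A).toRingHom.comp i) xc v) :=
  Iff.rfl

end Predicate

section Carrier

variable {F : Type} [Field F] [NumberField F] [IsCMField F] (σ : F →+* ℂ)
  {μ : IdeleClassGroup F →ₜ* Circle} (hμ : IdeleClassGroup.IsConjugateSymplectic F μ)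

/-- **The `(λ_μ, r_μ)`-carrier with BULLET 3 REAL**: over the pin `σ : F → ℂ` (Liu's `E ⊆ ℂ`), for `(A, i)` the type of pairs
`(θ₂, r)` with `θ₂ ∈ H²((A ⊗_{F,σ} ℂ)(ℂ); ℚ)` a polarisation class satisfying «`λ ∘ i_μ(x) = i_μ(x̄)^∨ ∘ λ` for every
`x ∈ M_μ`» (`IsPolarisationClass` along the inclusion `M_μ ⊆ ℂ`, so `x̄` IS complex conjugation in `M_μ ⊆ ℂ`, l. 1928) and
`r : R A i` an inhabitant of the still-posited FOURTH BULLET `r_μ` (l. 1957; ⟨CARRIER⟩ token `R` — no algebraic de Rham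
homology `H_1^{dR}(A_μ/E)` in the tree).  Use: `Carriers.ofPolDR μ (PolDR σ hμ R)`.  DEFINED.
[cite: Liu2021, Def. 4.5 (2) (TeX ll. 1955–1957)] -/
def PolDR (R : ∀ A : AbelianVariety F, (IdeleClassGroup.muAlgValueField F μ →+* A.endAlgebra) → Type)
    (A : AbelianVariety F) (i : IdeleClassGroup.muAlgValueField F μ →+* A.endAlgebra) : Type :=
  letI : Algebra F ℂ := σ.toAlgebra
  haveI := hμ.numberField_muAlgValueField
  {θ₂ : bettiCohomology (A.baseChange ℂ).X 2 //
      IsPolarisationClass (IdeleClassGroup.muAlgValueField F μ).subtype A i θ₂} × R A i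

/-- `PolDR σ hμ R A i` is inhabited iff `(A, i)` carries a polarisation class satisfying bullet 3 along `σ` AND the de Rham
token `R A i` is inhabited. [cite: Liu2021, Def. 4.5 (2) (TeX ll. 1955–1957)] -/
theorem nonempty_polDR_iff
    (R : ∀ A : AbelianVariety F, (IdeleClassGroup.muAlgValueField F μ →+* A.endAlgebra) → Type)
    (A : AbelianVariety F) (i : IdeleClassGroup.muAlgValueField F μ →+* A.endAlgebra) :
    Nonempty (PolDR σ hμ R A i) ↔
      (letI : Algebra F ℂ := σ.toAlgebra
       haveI := hμ.numberField_muAlgValueField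
       ∃ θ₂ : bettiCohomology (A.baseChange ℂ).X 2,
         IsPolarisationClass (IdeleClassGroup.muAlgValueField F μ).subtype A i θ₂) ∧ Nonempty (R A i) := by
  constructor
  · rintro ⟨⟨⟨θ₂, hθ₂⟩, r⟩⟩
    exact ⟨⟨θ₂, hθ₂⟩, ⟨r⟩⟩
  · rintro ⟨⟨θ₂, hθ₂⟩, ⟨r⟩⟩
    exact ⟨⟨⟨θ₂, hθ₂⟩, r⟩⟩

end Carrier

/-! ## §2 Supply: every structure of CM type carries a polarisation class satisfying bullet 3 -/

section Supply

variable {K : Type} [Field K] [NumberField K] [IsCMField K]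

/-- **From the integral to the rational Rosati relation.**  Let `A/ℂ` be an abelian variety, `φ : K → End⁰(A)` a rational
action of a CM field extending `ι : 𝓞_K → End(A)` (`φ(a) = 1 ⊗ ι(a)`), and `Q` a `ℂ`-bilinear pairing on `H¹(A(ℂ); ℂ)` with
values anywhere, such that `Q(ι(a)^*x, y) = Q(x, ι(ā)^*y)` for all `a ∈ 𝓞_K` (the shape of
`IsCMTypeRealisation.exists_rosati_ratClass`).  Then `Q(φ(x)^*u, v) = Q(u, φ(x̄)^*v)` for ALL `x ∈ K`, `x̄` the complex
conjugate, `φ(x)^* = complexAction φ x`: write `b x = a` with `a, b ∈ 𝓞_K`, `b ≠ 0` (`K = Frac 𝓞_K`), put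
`u = φ(b)^* u''`; then `Q(φ(x)^*u, v) = Q(φ(a)^*u'', v) = Q(u'', φ(ā)^*v) = Q(u'', φ(b̄)^* φ(x̄)^* v) = Q(φ(b)^*u'', φ(x̄)^*v)`.
[cite: Shimura1998, §5.1–§5.2 (the order `𝔯 = ι⁻¹(End A)` and the representation on `H¹`) and §6.2 Theorem 4 (3)] -/
theorem pairing_complexAction_eq_of_integer {A : AbelianVariety ℂ} (φ : K →+* A.endAlgebra) {ι : 𝓞 K →+* End A}
    (hφι : ∀ a : 𝓞 K, φ (a : K) = AbelianVariety.endAlgebra.of A (ι a))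
    {V : Type} [AddCommGroup V] [Module ℂ V]
    (Q : complexBetti A.X 1 →ₗ[ℂ] complexBetti A.X 1 →ₗ[ℂ] V)
    (hQ : ∀ (a ac : 𝓞 K), (ac : K) = IsCMField.complexConj K (a : K) → ∀ x y : complexBetti A.X 1,
      Q ((complexBetti.map (ι a).hom.hom.hom 1).hom x) y = Q x ((complexBetti.map (ι ac).hom.hom.hom 1).hom y))
    (x xc : K) (hxc : xc = IsCMField.complexConj K x) (u v : complexBetti A.X 1) :
    Q (complexAction φ x u) v = Q u (complexAction φ xc v) := by
  -- the integral relation through `complexAction`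
  have hQ' : ∀ (a ac : 𝓞 K), (ac : K) = IsCMField.complexConj K (a : K) → ∀ x y : complexBetti A.X 1,
      Q (complexAction φ (a : K) x) y = Q x (complexAction φ (ac : K) y) := fun a ac hac x y => by
    rw [← complexAction_integer φ hφι a, ← complexAction_integer φ hφι ac]
    exact hQ a ac hac x y
  -- clear denominators: `b • x = a` with `a, b ∈ 𝓞_K`, `b` a non-zero-divisor
  obtain ⟨b, a, ha⟩ := IsLocalization.exists_integer_multiple (nonZeroDivisors (𝓞 K)) x
  have hb0 : ((b : 𝓞 K) : K) ≠ 0 := by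
    rw [Ne, ← map_zero (algebraMap (𝓞 K) K), (IsFractionRing.injective (𝓞 K) K).eq_iff]
    exact nonZeroDivisors.ne_zero b.2
  have ha' : ((a : 𝓞 K) : K) = (b : 𝓞 K) * x := by
    have h := ha
    rw [Algebra.smul_def] at h
    exact h
  -- the conjugates `ā`, `b̄` are again integers
  set c : K →+* K := ((IsCMField.complexConj K).toRingEquiv : K →+* K) with hc
  have hca : IsIntegral ℤ (c (a : K)) := map_isIntegral_int c (RingOfIntegers.isIntegral_coe a)
  have hcb : IsIntegral ℤ (c ((b : 𝓞 K) : K)) := map_isIntegral_int c (RingOfIntegers.isIntegral_coe (b : 𝓞 K))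
  set ac : 𝓞 K := ⟨c (a : K), hca⟩ with hac
  set bc : 𝓞 K := ⟨c ((b : 𝓞 K) : K), hcb⟩ with hbc
  have hacK : (ac : K) = IsCMField.complexConj K (a : K) := rfl
  have hbcK : (bc : K) = IsCMField.complexConj K ((b : 𝓞 K) : K) := rfl
  have hac' : (ac : K) = (bc : K) * xc := by
    rw [hacK, hbcK, hxc, ha', map_mul]
  -- `u = φ(b)^* u''` with `u'' = φ(b⁻¹)^* u`
  set u'' : complexBetti A.X 1 := complexAction φ ((b : 𝓞 K) : K)⁻¹ u with hu''
  have hu : u = complexAction φ ((b : 𝓞 K) : K) u'' := by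
    rw [hu'', ← Module.End.mul_apply, ← map_mul, mul_inv_cancel₀ hb0, map_one, Module.End.one_apply]
  calc Q (complexAction φ x u) v
      = Q (complexAction φ (a : K) u'') v := by
          rw [hu, ← Module.End.mul_apply, ← map_mul, mul_comm, ha']
    _ = Q u'' (complexAction φ (ac : K) v) := hQ' a ac hacK u'' v
    _ = Q u'' (complexAction φ (bc : K) (complexAction φ xc v)) := by
          rw [hac', map_mul, Module.End.mul_apply]
    _ = Q (complexAction φ ((b : 𝓞 K) : K) u'') (complexAction φ xc v) := (hQ' (b : 𝓞 K) bc hbcK u'' _).symm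
    _ = Q u (complexAction φ xc v) := by rw [← hu]

variable {k : Type} [Field k] [Algebra k ℂ]

/-- **Every structure of CM type carries a polarisation class satisfying the third bullet of [Liu2021] Def. 4.5 (2).**
For a CM field `K`, any embedding `τ₀ : K → ℂ`, a structure `(A₀, ι₀ : 𝓞_K → End A₀)` of CM type `(K, Φ)` over `k ⊆ ℂ`
(`IsCMTypeRealisationOver`) and its rational extension `i : K → End⁰(A₀)` (`i(a) = 1 ⊗ ι₀(a)`), there is
`θ₂ ∈ H²(A₀ ⊗_k ℂ (ℂ); ℚ)` with `IsPolarisationClass τ₀ A₀ i θ₂`: the tree theorem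
`IsCMTypeRealisation.exists_rosati_ratClass` ([Shimura1998] §6.2 Thm. 4 (3): a rational algebraic class, a non-zero real
multiple of a Kähler class, with `Q(ι(a)^*x, y) = Q(x, ι(ā)^*y)` on `𝓞_K`) at the base change, transported to the rational
action by `pairing_complexAction_eq_of_integer`; `τ₀ x̄ = conj (τ₀ x)` forces `x̄ = ā`-conjugation since every complex
embedding of a CM field intertwines complex conjugations (Mathlib `IsCMField.complexEmbedding_complexConj`).  This is
«the obvious choice of `λ_μ`» of [Liu2021] l. 1984 ([Shi71] Thm. 5). [cite: Liu2021, proof of Prop. 4.6 (1) (TeX ll. 1982–1984)]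
[cite: Shimura1998, §6.2 Theorem 4 (3)] [cite: MilneCM2006, Ch. I Example 2.9 and Prop. 3.17] -/
theorem exists_isPolarisationClass_of_isCMTypeRealisationOver (τ₀ : K →+* ℂ) {Φ : CMType K}
    {A₀ : AbelianVariety k} {ι₀ : 𝓞 K →+* End A₀} (hA : IsCMTypeRealisationOver Φ A₀ ι₀)
    {i : K →+* A₀.endAlgebra} (hi : ∀ a : 𝓞 K, i (algebraMap (𝓞 K) K a) = AbelianVariety.endAlgebra.of A₀ (ι₀ a)) :
    ∃ θ₂ : bettiCohomology (A₀.baseChange ℂ).X 2, IsPolarisationClass τ₀ A₀ i θ₂ := by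
  obtain ⟨θ, hθ⟩ := hA
  obtain ⟨θ₂, halg, hK, -, -, hros⟩ := hθ.exists_rosati_ratClass
  have hφι : ∀ a : 𝓞 K, ((AbelianVariety.endAlgebraBaseChange ℂ A₀).toRingHom.comp i) (a : K) =
      AbelianVariety.endAlgebra.of (A₀.baseChange ℂ) (((A₀.endBaseChange ℂ).comp ι₀) a) := fun a => by
    rw [RingHom.comp_apply, RingHom.comp_apply, AbelianVariety.endBaseChange_apply]
    change AbelianVariety.endAlgebraBaseChange ℂ A₀ (i (algebraMap _ _ a)) = _
    rw [hi a, AbelianVariety.endAlgebraBaseChange_of]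
  refine ⟨θ₂, halg, hK, fun x xc hxc u v => ?_⟩
  have hxc' : xc = IsCMField.complexConj K x := by
    apply τ₀.injective
    rw [hxc, IsCMField.complexEmbedding_complexConj K τ₀ x]
  exact pairing_complexAction_eq_of_integer ((AbelianVariety.endAlgebraBaseChange ℂ A₀).toRingHom.comp i) hφι
    (polarizationPairingOne (A₀.baseChange ℂ).X (ofRatClass (ComplexPoints (A₀.baseChange ℂ).X) 2 θ₂)
      ((A₀.baseChange ℂ).dim - 1))
    (fun a ac hac x y => hros a ac hac x y) x xc hxc' u v

end Supply

/-! ## §3 [Liu2021] Prop. 4.6 (1) «`𝒜(μ)` is nonempty» over the polarised carrier -/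

section Main

variable {F : Type} [Field F] [NumberField F] [IsCMField F] [IsGalois ℚ F] (σ : F →+* ℂ)
  {μ : IdeleClassGroup F →ₜ* Circle} (hμ : IdeleClassGroup.IsConjugateSymplectic F μ)
  (hw : IdeleClassGroup.HasWeight F μ 1)

/-- **[Liu2021, Prop. 4.6 (1)] «`𝒜(μ)` is nonempty» from Casselman's theorem — SUPPLY-PARAMETRIC FORM.**  b25's
`nonempty_cmDatum_of_casselman` (tree `Prop46NonemptyOfCasselman`, p314768) VERBATIM, except that the inhabitant of the
`(λ_μ, r_μ)`-carrier `P` is demanded ONLY at integral structures `(A, ι₀ : 𝓞_{M_μ} → End A)` of CM type `(M_μ, Ψ̃_μ)` over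
`F` (`IsCMTypeRealisationOver`, along `σ`) together with their rational extension `i` (`i(a) = 1 ⊗ ι₀(a)`) — which is
what Casselman's theorem produces — instead of at every pair `(A, i)`.  GIVEN the cite `h21` ([Shimura1998] Thm. 21.4),
the displayed `μ`-hypotheses `hu`/`hπ` ((19.10b) ideal clause at local units / uniformisers) and such a supply `hP`,
there is a CM datum over `Carriers.ofPolDR μ P`.  Proof = b25's (credit: pub-hodgecm2-b25): Casselman at
`(K, Φ) = (M_μ, Ψ̃_μ)`, `k = F`; `i` by `exists_ringHom_endAlgebra`; bullet 1 by `det45_of_inducedCMType_eq_cmType` over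
`cmType_eq_of_isCMTypeRealisation_holds`; bullet 2 by `isCMCharacterMuAlgHecke_of_frobenius`.
[cite: Liu2021, Prop. 4.6 (1) (TeX l. 1969) and its proof (ll. 1975–1984)] [cite: Shimura1998, §21.4 Thm. 21.4]
[cite: Shimura1971ZetaCM, Theorem 6] -/
theorem nonempty_cmDatum_of_casselman_of_supply (h21 : shimura1998_thm21_4_casselman)
    (hu : haveI := hμ.numberField_muAlgValueField
      ∀ (v : HeightOneSpectrum (𝓞 F)) (u : (v.adicCompletionIntegers F)ˣ),
        ∃ b : (𝓞 (IdeleClassGroup.muAlgValueField F μ))ˣ,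
          (((IdeleClassGroup.muAlg F μ).localComponent v
              (Units.map ((v.adicCompletionIntegers F).subtype : _ →* _) u) : ℂˣ) : ℂ) =
            (IdeleClassGroup.muAlgValueField F μ).subtype
              ((b : 𝓞 (IdeleClassGroup.muAlgValueField F μ)) : IdeleClassGroup.muAlgValueField F μ))
    (hπ : haveI := hμ.numberField_muAlgValueField
      ∀ v : HeightOneSpectrum (𝓞 F), ∃ π : 𝓞 (IdeleClassGroup.muAlgValueField F μ),
        (IdeleClassGroup.muAlg F μ).valueAtUniformizer v =
            (IdeleClassGroup.muAlgValueField F μ).subtype (π : IdeleClassGroup.muAlgValueField F μ) ∧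
          ∀ (L : Type) [Field L] [NumberField L] [Normal ℚ L] (ιL : L →+* ℂ)
            (j : IdeleClassGroup.muAlgValueField F μ →+* L) (σL : F →+* L), ιL.comp σL = σ →
            IsReflexTypeNorm
              (valuedIn ιL (inducedCMType (incl (AlgHom.id ℚ F) σ hμ) (reflexCMType σ hμ.cmType (AlgHom.id ℚ F))).1)
              j σL v.asIdeal (Ideal.span {π}))
    (P : ∀ A : AbelianVariety F, (IdeleClassGroup.muAlgValueField F μ →+* A.endAlgebra) → Type)
    (hP : letI : Algebra F ℂ := σ.toAlgebra
      haveI := hμ.numberField_muAlgValueField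
      ∀ (A : AbelianVariety F) (ι₀ : 𝓞 (IdeleClassGroup.muAlgValueField F μ) →+* End A)
        (i : IdeleClassGroup.muAlgValueField F μ →+* A.endAlgebra),
        (∀ a, i (algebraMap _ (IdeleClassGroup.muAlgValueField F μ) a) = AbelianVariety.endAlgebra.of A (ι₀ a)) →
        IsCMTypeRealisationOver
          (inducedCMType (incl (AlgHom.id ℚ F) σ hμ) (reflexCMType σ hμ.cmType (AlgHom.id ℚ F))) A ι₀ →
        Nonempty (P A i)) :
    Nonempty (CMDatum (AlgHom.id ℚ F) σ hμ hw (Carriers.ofPolDR μ P)) := by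
  haveI := hμ.numberField_muAlgValueField
  haveI := hμ.isCMField_muAlgValueField
  letI : Algebra F ℂ := σ.toAlgebra
  have hσ : algebraMap F ℂ = σ := RingHom.algebraMap_toAlgebra σ
  -- Casselman's theorem at `(K, Φ) = (M_μ, Ψ̃_μ)`, `k = F`, `τ₀ = (M_μ ⊆ ℂ)`, `χ = μ^alg` (b25)
  obtain ⟨A₀, ι₀, hA, χfam, hχ, hfrob⟩ :=
    shimura1998_thm21_4_casselman.exists_structure (k := F) (K := IdeleClassGroup.muAlgValueField F μ)
      (Φ := inducedCMType (incl (AlgHom.id ℚ F) σ hμ) (reflexCMType σ hμ.cmType (AlgHom.id ℚ F)))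
      (τ₀ := (IdeleClassGroup.muAlgValueField F μ).subtype) (χ := IdeleClassGroup.muAlg F μ) h21
      (by
        rw [hσ]
        have hK := traceField_inducedCMType_reflexCMType_subset_range hμ.cmType (AlgHom.id ℚ F) σ
          (incl (AlgHom.id ℚ F) σ hμ)
        have hσ' : σ.comp ((AlgHom.id ℚ F : F →ₐ[ℚ] F) : F →+* F) = σ := RingHom.ext fun _ => rfl
        rw [hσ'] at hK
        exact hK)
      (by rw [hσ]; exact hasInfinityType_muAlg_cmInfinityType σ hμ hw)
      (fun x hx => ⟨exists_coe_muAlg_eq (μ := μ) x hx, coe_muAlg_mul_conj (μ := μ) x⟩) hu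
      (fun v => by
        obtain ⟨π, hπv, hπL⟩ := hπ v
        exact ⟨π, hπv, fun L _ _ _ ιL j σL hc => hπL L ιL j σL (by rw [← hσ]; exact hc)⟩)
  -- the rational extension `i : M_μ → End⁰(A₀)` of `ι₀`
  obtain ⟨i, hi⟩ := exists_ringHom_endAlgebra (A₀ := A₀) ι₀
  have hdim : Module.finrank ℚ (IdeleClassGroup.muAlgValueField F μ) = 2 * A₀.dim := hA.finrank_eq
  -- the supply at the Casselman structure
  have hPA : Nonempty (P A₀ i) := hP A₀ ι₀ i hi hA
  -- the CM type of `A₀ ⊗_{F,σ} ℂ` read on `H^{1,0}` through `i ⊗ ℂ` is `Ψ̃_μ`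
  obtain ⟨θ, hθ⟩ := hA
  have hφι : ∀ a : 𝓞 (IdeleClassGroup.muAlgValueField F μ),
      ((AbelianVariety.endAlgebraBaseChange ℂ A₀).toRingHom.comp i) (a : IdeleClassGroup.muAlgValueField F μ) =
        AbelianVariety.endAlgebra.of (A₀.baseChange ℂ) (((A₀.endBaseChange ℂ).comp ι₀) a) := fun a => by
    rw [RingHom.comp_apply, RingHom.comp_apply, AbelianVariety.endBaseChange_apply]
    change AbelianVariety.endAlgebraBaseChange ℂ A₀ (i (algebraMap _ _ a)) = _
    rw [hi a, AbelianVariety.endAlgebraBaseChange_of]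
  have hdimℂ : Module.finrank ℚ (IdeleClassGroup.muAlgValueField F μ) = 2 * (A₀.baseChange ℂ).dim := by
    rw [AbelianVariety.dim_baseChange]; exact hdim
  have hΨ := (cmType_eq_of_isCMTypeRealisation_holds
    ((AbelianVariety.endAlgebraBaseChange ℂ A₀).toRingHom.comp i) hdimℂ hφι hθ).symm
  refine ⟨{ A := A₀
            i := i
            finrank_eq := hdim
            det45 := fun x M f hM h =>
              det45_of_inducedCMType_eq_cmType σ hμ A₀ i hdim (incl (AlgHom.id ℚ F) σ hμ)
                (coe_incl (AlgHom.id ℚ F) σ hμ) hΨ x M f hM h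
            isCMCharacter := ?_
            polDR := hPA.some }⟩
  -- the second bullet
  rw [Carriers.ofPolDR_isCMCharacter]
  exact isCMCharacterMuAlgHecke_of_frobenius ι₀ i hi χfam hχ hfrob

/-- **[Liu2021, Prop. 4.6 (1)] «`𝒜(μ)` is nonempty» WITH BULLET 3 PROVED.**  For a CM field `F` Galois over `ℚ`, a pin
`σ : F → ℂ`, `μ` conjugate symplectic of weight one: GIVEN the cite `h21` ([Shimura1998] Thm. 21.4 = Casselman's theorem),
the displayed `μ`-hypotheses `hu`/`hπ` of b25's `Prop46NonemptyOfCasselman` ((19.10b) ideal clause; discharged in its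
sequels) and an inhabitant `hR` of the DE RHAM token `R` (bullet 4, l. 1957) only, there is a CM datum
`D_μ = (A_μ, i_μ, λ_μ, r_μ)` over the carrier `Carriers.ofPolDR μ (PolDR σ hμ R)`: bullets 1–2 as in b25's file, and the
THIRD BULLET — a polarisation class `θ₂` of `A_μ ⊗_{F,σ} ℂ` with «`λ ∘ i_μ(x) = i_μ(x̄)^∨ ∘ λ` for every `x ∈ M_μ`»
(`IsPolarisationClass`) — SUPPLIED by `exists_isPolarisationClass_of_isCMTypeRealisationOver` ([Shimura1998] §6.2 Thm. 4
(3) at the Casselman structure; Liu l. 1984 «the obvious choices of `λ_μ`»).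
[cite: Liu2021, Prop. 4.6 (1) (TeX l. 1969) and its proof (ll. 1975–1984); Def. 4.5 (2) (l. 1955)]
[cite: Shimura1998, §21.4 Thm. 21.4 and §6.2 Theorem 4 (3)] [cite: Shimura1971ZetaCM, Theorem 5 and Theorem 6] -/
theorem nonempty_cmDatum_polarised_of_casselman (h21 : shimura1998_thm21_4_casselman)
    (hu : haveI := hμ.numberField_muAlgValueField
      ∀ (v : HeightOneSpectrum (𝓞 F)) (u : (v.adicCompletionIntegers F)ˣ),
        ∃ b : (𝓞 (IdeleClassGroup.muAlgValueField F μ))ˣ,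
          (((IdeleClassGroup.muAlg F μ).localComponent v
              (Units.map ((v.adicCompletionIntegers F).subtype : _ →* _) u) : ℂˣ) : ℂ) =
            (IdeleClassGroup.muAlgValueField F μ).subtype
              ((b : 𝓞 (IdeleClassGroup.muAlgValueField F μ)) : IdeleClassGroup.muAlgValueField F μ))
    (hπ : haveI := hμ.numberField_muAlgValueField
      ∀ v : HeightOneSpectrum (𝓞 F), ∃ π : 𝓞 (IdeleClassGroup.muAlgValueField F μ),
        (IdeleClassGroup.muAlg F μ).valueAtUniformizer v =
            (IdeleClassGroup.muAlgValueField F μ).subtype (π : IdeleClassGroup.muAlgValueField F μ) ∧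
          ∀ (L : Type) [Field L] [NumberField L] [Normal ℚ L] (ιL : L →+* ℂ)
            (j : IdeleClassGroup.muAlgValueField F μ →+* L) (σL : F →+* L), ιL.comp σL = σ →
            IsReflexTypeNorm
              (valuedIn ιL (inducedCMType (incl (AlgHom.id ℚ F) σ hμ) (reflexCMType σ hμ.cmType (AlgHom.id ℚ F))).1)
              j σL v.asIdeal (Ideal.span {π}))
    (R : ∀ A : AbelianVariety F, (IdeleClassGroup.muAlgValueField F μ →+* A.endAlgebra) → Type)
    (hR : ∀ A i, Nonempty (R A i)) :
    Nonempty (CMDatum (AlgHom.id ℚ F) σ hμ hw (Carriers.ofPolDR μ (PolDR σ hμ R))) := by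
  refine nonempty_cmDatum_of_casselman_of_supply σ hμ hw h21 hu hπ (PolDR σ hμ R) fun A ι₀ i hi hA => ?_
  haveI := hμ.numberField_muAlgValueField
  haveI := hμ.isCMField_muAlgValueField
  letI : Algebra F ℂ := σ.toAlgebra
  obtain ⟨θ₂, hθ₂⟩ := exists_isPolarisationClass_of_isCMTypeRealisationOver
    (IdeleClassGroup.muAlgValueField F μ).subtype hA hi
  exact ⟨⟨⟨θ₂, hθ₂⟩, (hR A i).some⟩⟩

end Main

end Literature.NumberTheory.Automorphic.Liu2021.Def45

end
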